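import Literature.NumberTheory.Automorphic.BrandtModuleMaximalLocal
import HarnessLib

/-!
# Residual classification I: matrix units from a non-degenerate idempotent; the degenerate
# idempotent contradicts maximality

Seventh layer of the proof files for the named fact `brandtMatrix_comm` of `BrandtModule.lean`
(Vignéras, LNM 800, III §5 ex. 5.8; Eichler 1973, II §6 Thm. 2). Residual substitute for
Vignéras II §2 Thm. 2.3 (at a split prime a maximal order is `M₂(ℤ_p)` up to conjugation), for
`A = O / p O` and a non-trivial idempotent `e ∈ A` (then `ē = f = 1 − e`,
`BrandtModuleResidueInvolution.lean`) with small diagonal corners `|eAe| = |fAf| = p`: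

* `IsZOrder.peirceCorner_eq_zmultiples` — a corner of order `p` containing `c ≠ 0` is `ℤ c`;
* **matrix units** (`IsZOrder.isResiduallySplit_of_mul_ne_zero`): if some `u ∈ eAf`, `v ∈ fAe`
  have `u v ≠ 0`, then after rescaling `u v = e`, `v u = f`, all four corners are the lines
  through `e, u, v, f`, and lifting to `O` gives `IsResiduallySplit` (Vignéras II §2: the residue
  algebra is `M₂(𝔽_p)`);
* **the degenerate case contradicts maximality** (`IsMaximalZOrder.false_of_degenerate`): if
  `eAf · fAe = 0 = fAe · eAf` but `fAe ∋ y₀ ≠ 0`, lift `e` to `E` with `E² ≡ E (mod p²)`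
  (`exists_lift_idempotent_sq`), put `y = (1 − E) ỹ₀ E` and
  `𝔄 = {a ∈ O₁ | E a E ∈ p O₁}`; then `𝔄` is a left `O₁`-stable lattice between `p O₁` and `O₁`
  and `(y/p) 𝔄 ⊆ 𝔄`, so `y ∈ p O₁` by **(M1)** — contradicting `res y = y₀ ≠ 0`. (This is the
  residual shadow of the fact that the Eichler order of level `p`, whose residue algebra has
  exactly this shape, is not maximal.) The mirror statement for `eAf ∋ y₀ ≠ 0` follows by
  exchanging `e` and `f`.

## References

* M.-F. Vignéras, *Arithmétique des algèbres de quaternions*, LNM 800 (1980), Ch. II §2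
  (Thm. 2.3, ordres d'Eichler locaux) [VignerasLNM800].
-/

noncomputable section

open scoped Pointwise

universe u

namespace Literature.NumberTheory.Automorphic

namespace IsZOrder

variable {B : Type u} [Ring B] [Algebra ℚ B] [IsQuaternionAlgebra ℚ B] {O : Submodule ℤ B} {p : ℕ}

/-! ### Corners of order `p` are lines -/

omit [Algebra ℚ B] [IsQuaternionAlgebra ℚ B] in
/-- **A Peirce corner of order `p` is the line through any of its non-zero elements**:
`corner = ℤ c = {(k : A) c}`. [folklore] -/
theorem peirceCorner_eq_zmultiples (hO : IsZOrder O) (hp : p.Prime) {e e' c : hO.Residue p}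
    (hc : c ∈ peirceCorner e e') (hc0 : c ≠ 0) (hcard : Nat.card (peirceCorner e e') = p) :
    ∀ a ∈ peirceCorner e e', ∃ k : ℤ, a = (k : hO.Residue p) * c := by
  haveI : Fact p.Prime := ⟨hp⟩
  haveI : Finite (peirceCorner e e') := Nat.finite_of_card_ne_zero (by rw [hcard]; exact hp.ne_zero)
  have hord : addOrderOf c = p :=
    addOrderOf_eq_prime (by rw [nsmul_eq_mul, natCast_self_residue, zero_mul]) hc0
  have hle : AddSubgroup.zmultiples c ≤ peirceCorner e e' := AddSubgroup.zmultiples_le_of_mem hc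
  have heq : AddSubgroup.zmultiples c = peirceCorner e e' :=
    AddSubgroup.eq_of_le_of_card_ge hle (by rw [hcard, Nat.card_zmultiples, hord])
  intro a ha
  rw [← heq, AddSubgroup.mem_zmultiples_iff] at ha
  obtain ⟨k, rfl⟩ := ha
  exact ⟨k, by rw [zsmul_eq_mul]⟩

omit [Algebra ℚ B] [IsQuaternionAlgebra ℚ B] in
/-- `(k : A) c = 0` with `c ≠ 0` forces `p ∣ k`. [folklore] -/
theorem dvd_of_intCast_mul_eq_zero (hO : IsZOrder O) (hp : p.Prime) {c : hO.Residue p} (hc0 : c ≠ 0)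
    {k : ℤ} (hk : (k : hO.Residue p) * c = 0) : (p : ℤ) ∣ k := by
  by_contra hnd
  obtain ⟨l, hl⟩ := hO.exists_intCast_mul_eq_one hp hnd
  exact hc0 (by rw [← one_mul c, ← hl, mul_assoc, hk, mul_zero])

/-! ### Matrix units from a non-degenerate idempotent -/

/-- **Matrix units in `A = O / p O`** from a non-trivial idempotent `e` (`ē = 1 − e`) with
`|eAe| = |fAf| = p`, `|eAf| |fAe| = p²` and elements `u₀ ∈ eAf`, `v ∈ fAe` with `u₀ v ≠ 0`:
there is `u ∈ eAf` with `u v = e`, `v u = 1 − e`, and `e, u, v, 1 − e` span `A` over `ℤ`.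
(`u₀ v = λ e` with `p ∤ λ`; rescale; `(v u)² = v u ∈ ℤ f` is `0` or `f`, and `0` would give
`v = v (u v) = 0`.) [cite: VignerasLNM800, Ch. II §2 Thm. 2.3] -/
theorem exists_matrix_units (hO : IsZOrder O) (hp : p.Prime) {e : hO.Residue p} (he : IsIdempotentElem e)
    (h0 : e ≠ 0) (hee : Nat.card (peirceCorner e e) = p)
    (hff : Nat.card (peirceCorner (1 - e) (1 - e)) = p)
    (hoff : Nat.card (peirceCorner e (1 - e)) * Nat.card (peirceCorner (1 - e) e) = p ^ 2)
    {u₀ v : hO.Residue p} (hu₀ : u₀ ∈ peirceCorner e (1 - e)) (hv : v ∈ peirceCorner (1 - e) e)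
    (huv : u₀ * v ≠ 0) :
    ∃ u ∈ peirceCorner e (1 - e), u * v = e ∧ v * u = 1 - e ∧
      ∀ a : hO.Residue p, ∃ k₁ k₂ k₃ k₄ : ℤ,
        a = (k₁ : hO.Residue p) * e + (k₂ : hO.Residue p) * u + (k₃ : hO.Residue p) * v +
          (k₄ : hO.Residue p) * (1 - e) := by
  have hf := he.one_sub
  have hf0 : (1 : hO.Residue p) - e ≠ 0 := fun h => by
    -- `e = 1` would make `eAf = 0`, contradicting `u₀ v ≠ 0`
    have hu0 : u₀ = 0 := by
      rw [mem_peirceCorner] at hu₀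
      rw [← hu₀, h, mul_zero]
    exact huv (by rw [hu0, zero_mul])
  -- the diagonal corners are the lines through `e` and `f`
  have heline := hO.peirceCorner_eq_zmultiples hp (mul_mul_mem_peirceCorner he he e |> fun h => by
    rwa [he.eq, he.eq] at h) h0 hee
  have hfline := hO.peirceCorner_eq_zmultiples hp (mul_mul_mem_peirceCorner hf hf (1 - e) |> fun h => by
    rwa [hf.eq, hf.eq] at h) hf0 hff
  -- `u₀ v = λ e`, `p ∤ λ`; rescale
  obtain ⟨lam, hlam⟩ := heline _ (mul_mem_peirceCorner hu₀ hv he he)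
  have hlam0 : ¬ (p : ℤ) ∣ lam := fun hd => huv (by
    rw [hlam, (hO.intCast_residue_eq_zero_iff hp).mpr hd, zero_mul])
  obtain ⟨l, hl⟩ := hO.exists_intCast_mul_eq_one hp hlam0
  set u : hO.Residue p := (l : hO.Residue p) * u₀ with hu_def
  have hu : u ∈ peirceCorner e (1 - e) := by
    rw [mem_peirceCorner] at hu₀ ⊢
    rw [hu_def, ← mul_assoc e, ← (Int.cast_commute l e).eq, mul_assoc (l : hO.Residue p) e u₀,
      mul_assoc (l : hO.Residue p), hu₀]
  have huv1 : u * v = e := by rw [hu_def, mul_assoc, hlam, ← mul_assoc, hl, one_mul]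
  -- `v u = μ f` is an idempotent multiple of `f`
  obtain ⟨mu, hmu⟩ := hfline _ (mul_mem_peirceCorner hv hu hf hf)
  have hve : v * e = v := mul_right_eq_self_of_mem_peirceCorner he hv
  have hvu_idem : v * u * (v * u) = v * u := by
    calc v * u * (v * u) = v * (u * v) * u := by noncomm_ring
      _ = v * u := by rw [huv1, hve]
  have hmu01 : (p : ℤ) ∣ mu * mu - mu := by
    have h1 : ((mu * mu - mu : ℤ) : hO.Residue p) * (1 - e) = 0 := by
      rw [Int.cast_sub, Int.cast_mul, sub_mul, mul_assoc, ← hmu]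
      conv_lhs => rw [show (mu : hO.Residue p) * (v * u) = (mu : hO.Residue p) * (1 - e) * (v * u) by
        rw [mul_assoc, mul_left_eq_self_of_mem_peirceCorner hf (mul_mem_peirceCorner hv hu hf hf)]]
      rw [← hmu, hvu_idem, sub_self]
    exact hO.dvd_of_intCast_mul_eq_zero hp hf0 h1
  have hv0 : v ≠ 0 := fun h => huv (by rw [h, mul_zero])
  -- `μ ≢ 0`: otherwise `v = v (u v) = (v u) v = 0`
  have hmu0 : ¬ (p : ℤ) ∣ mu := fun hd => hv0 (by
    have hvu0 : v * u = 0 := by rw [hmu, (hO.intCast_residue_eq_zero_iff hp).mpr hd, zero_mul]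
    calc v = v * e := hve.symm
      _ = v * (u * v) := by rw [huv1]
      _ = v * u * v := (mul_assoc v u v).symm
      _ = 0 := by rw [hvu0, zero_mul])
  -- hence `μ ≡ 1`
  have hmu1 : (mu : hO.Residue p) = 1 := by
    have hpZ : Prime (p : ℤ) := Nat.prime_iff_prime_int.mp hp
    have : (p : ℤ) ∣ mu * (mu - 1) := by rw [mul_sub, mul_one]; exact hmu01
    rcases hpZ.dvd_or_dvd this with h | h
    · exact absurd h hmu0
    · have := (hO.intCast_residue_eq_zero_iff hp).mpr h
      rwa [Int.cast_sub, Int.cast_one, sub_eq_zero] at this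
  have hvu1 : v * u = 1 - e := by rw [hmu, hmu1, one_mul]
  -- the off-diagonal corners are the lines through `u` and `v`
  have hu0 : u ≠ 0 := fun h => h0 (by rw [← huv1, h, zero_mul])
  obtain ⟨j, -, hj⟩ := hO.card_addSubgroup_residue hp (peirceCorner e (1 - e))
  obtain ⟨k, -, hk⟩ := hO.card_addSubgroup_residue hp (peirceCorner (1 - e) e)
  have hpj : p ∣ p ^ j := hj ▸ hO.dvd_card_of_ne_zero_mem hp hu hu0
  have hpk : p ∣ p ^ k := hk ▸ hO.dvd_card_of_ne_zero_mem hp hv hv0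
  have hj1 : 1 ≤ j := by
    rcases Nat.eq_zero_or_pos j with rfl | h
    · rw [pow_zero, Nat.dvd_one] at hpj; exact absurd hpj hp.one_lt.ne'
    · exact h
  have hk1 : 1 ≤ k := by
    rcases Nat.eq_zero_or_pos k with rfl | h
    · rw [pow_zero, Nat.dvd_one] at hpk; exact absurd hpk hp.one_lt.ne'
    · exact h
  rw [hj, hk, ← pow_add] at hoff
  have hjk : j + k = 2 := Nat.pow_right_injective hp.two_le hoff
  have hj' : j = 1 := by omega
  have hk' : k = 1 := by omega
  rw [hj', pow_one] at hj
  rw [hk', pow_one] at hk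
  have huline := hO.peirceCorner_eq_zmultiples hp hu hu0 hj
  have hvline := hO.peirceCorner_eq_zmultiples hp hv hv0 hk
  refine ⟨u, hu, huv1, hvu1, fun a => ?_⟩
  obtain ⟨k₁, h₁⟩ := heline _ (mul_mul_mem_peirceCorner he he a)
  obtain ⟨k₂, h₂⟩ := huline _ (mul_mul_mem_peirceCorner he hf a)
  obtain ⟨k₃, h₃⟩ := hvline _ (mul_mul_mem_peirceCorner hf he a)
  obtain ⟨k₄, h₄⟩ := hfline _ (mul_mul_mem_peirceCorner hf hf a)
  refine ⟨k₁, k₂, k₃, k₄, ?_⟩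
  rw [← h₁, ← h₂, ← h₃, ← h₄]
  exact ((peirceEquiv he).left_inv a).symm

/-! ### Lifting the matrix units: residually split -/

/-- **Residually split from matrix units**: a non-trivial idempotent `e = res x` of `O / p O`
(`ē = 1 − e`, `|eAe| = |fAf| = p`, `|eAf| |fAe| = p²`) together with `u₀ ∈ eAf`, `v₀ ∈ fAe`,
`u₀ v₀ ≠ 0` makes `O` residually split at `p` (lift `e, u, v` to `O`). [cite: VignerasLNM800, Ch. II §2 Thm. 2.3] -/
theorem isResiduallySplit_of_mul_ne_zero (hO : IsZOrder O) (hp : p.Prime) {x : hO.subring}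
    (he : IsIdempotentElem (hO.res p x)) (h0 : hO.res p x ≠ 0)
    (hee : Nat.card (peirceCorner (hO.res p x) (hO.res p x)) = p)
    (hff : Nat.card (peirceCorner (1 - hO.res p x) (1 - hO.res p x)) = p)
    (hoff : Nat.card (peirceCorner (hO.res p x) (1 - hO.res p x)) *
      Nat.card (peirceCorner (1 - hO.res p x) (hO.res p x)) = p ^ 2)
    {u₀ v₀ : hO.Residue p} (hu₀ : u₀ ∈ peirceCorner (hO.res p x) (1 - hO.res p x))
    (hv₀ : v₀ ∈ peirceCorner (1 - hO.res p x) (hO.res p x)) (huv : u₀ * v₀ ≠ 0) :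
    hO.IsResiduallySplit p := by
  set e := hO.res p x with he_def
  obtain ⟨u, hu, huv1, hvu1, hspan⟩ := hO.exists_matrix_units hp he h0 hee hff hoff hu₀ hv₀ huv
  obtain ⟨us, hus⟩ := hO.res_surjective p u
  obtain ⟨vs, hvs⟩ := hO.res_surjective p v₀
  have hf := he.one_sub
  -- relations in `A`
  have r_eu : e * u = u := mul_left_eq_self_of_mem_peirceCorner he hu
  have r_ue : u * e = 0 := mul_right_eq_zero_of_mem_peirceCorner hu he.one_sub_mul_self
  have r_uu : u * u = 0 := mul_eq_zero_of_mem_peirceCorner_off he hu hu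
  have r_vv : v₀ * v₀ = 0 := mul_eq_zero_of_mem_peirceCorner_off' he hv₀ hv₀
  have r_ev : e * v₀ = 0 := mul_left_eq_zero_of_mem_peirceCorner hv₀ he.mul_one_sub_self
  have r_ve : v₀ * e = v₀ := mul_right_eq_self_of_mem_peirceCorner he hv₀
  -- translate `res s = 0` into membership in `p O`
  have key : ∀ s : hO.subring, hO.res p s = 0 → (s : B) ∈ (p : ℤ) • O := fun s hs => res_eq_zero_iff.mp hs
  refine ⟨x, us, vs, x.2, us.2, vs.2, ?_, ?_, ?_, ?_, ?_, ?_, ?_, ?_, ?_, fun y hy => ?_⟩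
  · exact key (x * x - x) (by rw [map_sub, map_mul, ← he_def, he.eq, sub_self])
  · exact key (x * us - us) (by rw [map_sub, map_mul, ← he_def, hus, r_eu, sub_self])
  · exact key (us * x) (by rw [map_mul, ← he_def, hus, r_ue])
  · exact key (us * us) (by rw [map_mul, hus, r_uu])
  · exact key (vs * vs) (by rw [map_mul, hvs, r_vv])
  · exact key (x * vs) (by rw [map_mul, ← he_def, hvs, r_ev])
  · exact key (vs * x - vs) (by rw [map_sub, map_mul, ← he_def, hvs, r_ve, sub_self])
  · exact key (us * vs - x) (by rw [map_sub, map_mul, hus, hvs, huv1, he_def, sub_self])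
  · exact key (vs * us - (1 - x)) (by rw [map_sub, map_sub, map_mul, map_one, hvs, hus, hvu1, he_def, sub_self])
  · obtain ⟨k₁, k₂, k₃, k₄, hk⟩ := hspan (hO.res p ⟨y, hy⟩)
    refine ⟨k₁, k₂, k₃, k₄, ?_⟩
    have h := key (⟨y, hy⟩ - ((k₁ : hO.subring) * x + (k₂ : hO.subring) * us +
      (k₃ : hO.subring) * vs + (k₄ : hO.subring) * (1 - x))) (by
        rw [map_sub, hk]
        simp only [map_add, map_mul, map_intCast, map_sub, map_one, hus, hvs, ← he_def, sub_self])
    have hcoe : (((⟨y, hy⟩ - ((k₁ : hO.subring) * x + (k₂ : hO.subring) * us +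
        (k₃ : hO.subring) * vs + (k₄ : hO.subring) * (1 - x)) : hO.subring)) : B) =
        y - (k₁ • (x : B) + k₂ • (us : B) + k₃ • (vs : B) + k₄ • (1 - (x : B))) := by
      simp [zsmul_eq_mul]
    rwa [hcoe] at h

/-! ### The degenerate idempotent contradicts maximality -/

omit [IsQuaternionAlgebra ℚ B] in
/-- **(M1) with a denominator**: under the hypotheses of `IsMaximalZOrder.mem_of_mul_le`, if
`y 𝔄 ⊆ p • 𝔄` then `y ∈ p • O₁` (apply (M1) to `y / p`). [cite: VignerasLNM800, Ch. I §4 Déf. p. 20 (ordre maximal)] -/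
theorem _root_.Literature.NumberTheory.Automorphic.IsMaximalZOrder.mem_smul_of_mul_le [IsAddTorsionFree B]
    {O₁ : Submodule ℤ B} (hmax : IsMaximalZOrder O₁) {𝔄 : Submodule ℤ B} {m : ℤ} (hm : m ≠ 0)
    (hlow : m • O₁ ≤ 𝔄) (hup : 𝔄 ≤ O₁) (hleft : ∀ x ∈ O₁, ∀ a ∈ 𝔄, x * a ∈ 𝔄) {p' : ℤ} (hp' : p' ≠ 0)
    {y : B} (hy : ∀ a ∈ 𝔄, y * a ∈ p' • 𝔄) : y ∈ p' • O₁ := by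
  have hpQ : (p' : ℚ) ≠ 0 := by exact_mod_cast hp'
  set y' : B := (p' : ℚ)⁻¹ • y with hy'
  have hyy' : y = p' • y' := by
    rw [hy', ← Int.cast_smul_eq_zsmul ℚ, smul_smul, mul_inv_cancel₀ hpQ, one_smul]
  have hy'mem : y' ∈ O₁ := by
    refine hmax.mem_of_mul_le hm hlow hup hleft fun a ha => ?_
    obtain ⟨c, hc, hyc⟩ := (Submodule.mem_smul_pointwise_iff_exists _ _ 𝔄).mp (hy a ha)
    have : y' * a = c := by
      apply smul_right_injective B hp'
      change p' • (y' * a) = p' • c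
      rw [hyc, ← smul_mul_assoc, ← hyy']
    rw [this]
    exact hc
  rw [hyy']
  exact Submodule.smul_mem_pointwise_smul _ p' O₁ hy'mem

omit [IsQuaternionAlgebra ℚ B] in
/-- **The degenerate idempotent contradicts maximality.** Let `O₁` be maximal, `e = res x` a
non-trivial idempotent of `A = O₁ / p O₁` with `eAf · fAe = 0` and `fAe · eAf = 0`, and suppose
`fAe ∋ y₀ ≠ 0`. Lift `e` to `E` with `E² ≡ E (mod p²)`, let `y = (1 − E) ỹ₀ E` and
`𝔄 = {a ∈ O₁ | E a E ∈ p O₁}`: a lattice, `p O₁ ⊆ 𝔄 ⊆ O₁`, left `O₁`-stable (because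
`e (za) e = (eze)(eae) + (ezf)(fae) ≡ 0`), with `y 𝔄 ⊆ p 𝔄` (`res (y a) = y₀ (e ā) = 0` and
`E (y a) E ∈ (E F) O₁ ⊆ p² O₁`); so `y ∈ p O₁` by (M1), i.e. `y₀ = res y = 0`. [cite: VignerasLNM800, Ch. I §4 and Ch. II §2] -/
theorem _root_.Literature.NumberTheory.Automorphic.IsMaximalZOrder.false_of_degenerate [IsAddTorsionFree B]
    {O₁ : Submodule ℤ B} (hO : IsZOrder O₁) (hmax : IsMaximalZOrder O₁) (hp : p.Prime)
    {x : hO.subring} (he : IsIdempotentElem (hO.res p x))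
    (hdeg : ∀ a ∈ peirceCorner (hO.res p x) (1 - hO.res p x),
      ∀ b ∈ peirceCorner (1 - hO.res p x) (hO.res p x), a * b = 0)
    (hdeg' : ∀ b ∈ peirceCorner (1 - hO.res p x) (hO.res p x),
      ∀ a ∈ peirceCorner (hO.res p x) (1 - hO.res p x), b * a = 0)
    {y₀ : hO.Residue p} (hy₀ : y₀ ∈ peirceCorner (1 - hO.res p x) (hO.res p x))
    (hy₀0 : y₀ ≠ 0) : False := by
  set e := hO.res p x with he_def
  have hf := he.one_sub
  have hpZ : (p : ℤ) ≠ 0 := by exact_mod_cast hp.ne_zero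
  -- lift `e` to `E` with `E² ≡ E (mod p²)`
  have hxx : (x : B) * x - x ∈ (p : ℤ) • O₁ :=
    res_eq_zero_iff.mp (show hO.res p (x * x - x) = 0 by rw [map_sub, map_mul, ← he_def, he.eq, sub_self])
  obtain ⟨E, hE, hEx, hEE⟩ := hO.exists_lift_idempotent_sq (p : ℤ) x.2 hxx
  set Es : hO.subring := ⟨E, hE⟩ with hEs
  have hresE : hO.res p Es = e := by
    rw [he_def, res_eq_res_iff]
    exact hEx
  obtain ⟨hEF, -⟩ := lift_mul_compl hEE
  -- the element `y = (1 − E) ỹ₀ E`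
  obtain ⟨ys, hys⟩ := hO.res_surjective p y₀
  set y : B := (1 - E) * ys * E with hy_def
  set Ys : hO.subring := (1 - Es) * ys * Es with hYs
  have hYy : (Ys : B) = y := by
    simp only [hYs, hy_def, hEs, Subring.coe_mul, AddSubgroupClass.coe_sub, Subring.coe_one]
  have hresY : hO.res p Ys = y₀ := by
    rw [hYs, map_mul, map_mul, map_sub, map_one, hresE, hys]
    exact mem_peirceCorner.mp hy₀
  -- the lattice `𝔄 = {a ∈ O₁ | E a E ∈ p O₁}`
  let 𝔄 : Submodule ℤ B := O₁ ⊓ ((p : ℤ) • O₁).comap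
    ((LinearMap.mulLeft ℤ E).comp (LinearMap.mulRight ℤ E))
  have hmem𝔄 : ∀ {a : B}, a ∈ 𝔄 ↔ a ∈ O₁ ∧ E * (a * E) ∈ (p : ℤ) • O₁ := fun {a} => Iff.rfl
  have hlow : (p : ℤ) • O₁ ≤ 𝔄 := fun a ha =>
    hmem𝔄.mpr ⟨smul_le O₁ _ ha, hO.mul_smul_mem hE (hO.smul_mul_mem ha hE)⟩
  have hup : 𝔄 ≤ O₁ := fun a ha => (hmem𝔄.mp ha).1
  -- residues of elements of `𝔄` have vanishing `e·e`-corner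
  have hcorner : ∀ {a : B} (ha : a ∈ 𝔄), e * hO.res p ⟨a, hup ha⟩ * e = 0 := fun {a} ha => by
    have h : hO.res p (Es * (⟨a, hup ha⟩ * Es)) = 0 := by
      rw [res_eq_zero_iff]
      simpa only [Subring.coe_mul, hEs] using (hmem𝔄.mp ha).2
    rw [map_mul, map_mul, hresE, ← mul_assoc] at h
    exact h
  -- `𝔄` is left `O₁`-stable
  have hleft : ∀ z ∈ O₁, ∀ a ∈ 𝔄, z * a ∈ 𝔄 := fun z hz a ha => by
    refine hmem𝔄.mpr ⟨hO.mul_mem _ hz _ (hup ha), ?_⟩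
    have hza : hO.res p (Es * (⟨z, hz⟩ * ⟨a, hup ha⟩ * Es)) = 0 := by
      rw [map_mul, map_mul, map_mul, hresE]
      set za := hO.res p ⟨z, hz⟩
      set aa := hO.res p ⟨a, hup ha⟩
      -- `e z a e = (e z e)(e a e) + (e z f)(f a e)`
      have hsplit : e * (za * aa * e) =
          (e * za * e) * (e * aa * e) + (e * za * (1 - e)) * ((1 - e) * aa * e) := by
        have h1 : e * e = e := he.eq
        have h2 : (1 - e) * (1 - e) = 1 - e := hf.eq
        calc e * (za * aa * e) = e * za * (e + (1 - e)) * aa * e := by noncomm_ring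
          _ = e * za * (e * e + (1 - e) * (1 - e)) * aa * e := by rw [h1, h2]
          _ = (e * za * e) * (e * aa * e) + (e * za * (1 - e)) * ((1 - e) * aa * e) := by noncomm_ring
      rw [hsplit, hcorner ha, mul_zero, zero_add]
      exact hdeg _ (mul_mul_mem_peirceCorner he hf za) _ (mul_mul_mem_peirceCorner hf he aa)
    have h := res_eq_zero_iff.mp hza
    simpa only [Subring.coe_mul] using h
  -- `y 𝔄 ⊆ p 𝔄`
  have hy𝔄 : ∀ a ∈ 𝔄, y * a ∈ (p : ℤ) • 𝔄 := fun a ha => by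
    -- `res (y a) = y₀ (e ā) = 0`
    have hya : hO.res p (Ys * ⟨a, hup ha⟩) = 0 := by
      rw [map_mul, hresY]
      set aa := hO.res p ⟨a, hup ha⟩
      have hy₀e : y₀ * e = y₀ := mul_right_eq_self_of_mem_peirceCorner he hy₀
      calc y₀ * aa = y₀ * e * aa * (e + (1 - e)) := by rw [hy₀e]; noncomm_ring
        _ = y₀ * (e * aa * e) + y₀ * (e * aa * (1 - e)) := by noncomm_ring
        _ = 0 := by
          rw [hcorner ha, mul_zero, zero_add]
          exact hdeg' _ hy₀ _ (mul_mul_mem_peirceCorner he hf aa)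
    have hya' : y * a ∈ (p : ℤ) • O₁ := by
      have h := res_eq_zero_iff.mp hya
      simpa only [Subring.coe_mul, hYy] using h
    obtain ⟨c, hc, hyac⟩ := (Submodule.mem_smul_pointwise_iff_exists _ _ O₁).mp hya'
    -- `c ∈ 𝔄`: `p • (E c E) = E (y a) E ∈ (E F) O₁ ⊆ p² O₁`
    have hc𝔄 : c ∈ 𝔄 := by
      refine hmem𝔄.mpr ⟨hc, ?_⟩
      refine mem_smul_of_smul_mem_smul O₁ hpZ ?_
      have : (p : ℤ) • (E * (c * E)) = E * (1 - E) * (ys * E * a * E) := by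
        rw [← mul_smul_comm, ← smul_mul_assoc, hyac, hy_def]
        noncomm_ring
      rw [this]
      exact hO.smul_mul_mem hEF (hO.mul_mem _ (hO.mul_mem _ (hO.mul_mem _ ys.2 _ hE) _ (hup ha)) _ hE)
    rw [← hyac]
    exact Submodule.smul_mem_pointwise_smul _ _ 𝔄 hc𝔄
  -- (M1): `y ∈ p O₁`, so `y₀ = res y = 0`
  have hymem : y ∈ (p : ℤ) • O₁ := hmax.mem_smul_of_mul_le hpZ hlow hup hleft hpZ hy𝔄
  apply hy₀0
  rw [← hresY, res_eq_zero_iff, hYy]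
  exact hymem

omit [IsQuaternionAlgebra ℚ B] in
/-- **The degenerate idempotent contradicts maximality, mirror form**: the same with
`eAf ∋ y₀ ≠ 0` (exchange the roles of `e` and `f = 1 − e`). [cite: VignerasLNM800, Ch. I §4 and Ch. II §2] -/
theorem _root_.Literature.NumberTheory.Automorphic.IsMaximalZOrder.false_of_degenerate' [IsAddTorsionFree B]
    {O₁ : Submodule ℤ B} (hO : IsZOrder O₁) (hmax : IsMaximalZOrder O₁) (hp : p.Prime)
    {x : hO.subring} (he : IsIdempotentElem (hO.res p x))
    (hdeg : ∀ a ∈ peirceCorner (hO.res p x) (1 - hO.res p x),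
      ∀ b ∈ peirceCorner (1 - hO.res p x) (hO.res p x), a * b = 0)
    (hdeg' : ∀ b ∈ peirceCorner (1 - hO.res p x) (hO.res p x),
      ∀ a ∈ peirceCorner (hO.res p x) (1 - hO.res p x), b * a = 0)
    {y₀ : hO.Residue p} (hy₀ : y₀ ∈ peirceCorner (hO.res p x) (1 - hO.res p x))
    (hy₀0 : y₀ ≠ 0) : False := by
  have h1x : hO.res p (1 - x) = 1 - hO.res p x := by rw [map_sub, map_one]
  have hsub : (1 : hO.Residue p) - (1 - hO.res p x) = hO.res p x := sub_sub_cancel _ _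
  refine IsMaximalZOrder.false_of_degenerate hO hmax hp (x := 1 - x) (y₀ := y₀) ?_ ?_ ?_ ?_ hy₀0
  · rw [h1x]; exact he.one_sub
  · rw [h1x, hsub]; exact hdeg'
  · rw [h1x, hsub]; exact hdeg
  · rw [h1x, hsub]; exact hy₀

end IsZOrder

end Literature.NumberTheory.Automorphic

end
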